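import Literature.Computability.AlgebraicComplexity.AsymptoticSpectrum
import Mathlib.Data.Fintype.Sort
import HarnessLib

/-!
# Tensor powers of a direct sum: decomposition into position blocks

Topic `Literature/Computability/AlgebraicComplexity`; tensor algebra for the sub-additivity of the
upper quantum functional under direct sums (M. Christandl, P. Vrana, J. Zuiddam, *Universal points in
the asymptotic spectrum of tensors*, J. Amer. Math. Soc. 36 (2023) = arXiv:1709.07851v3, proof of
**Lemma 3.11**: "`(s ⊕ t)^{⊗n}` decomposes as a direct sum over `m` and over the `\\binom{n}{m}` ways
of placing `m` copies of `s` and `n - m` copies of `t` on the `n` tensor legs").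

For 3-tensors `s ∈ K^{ι×κ×μ}`, `t ∈ K^{ι'×κ'×μ'}` (tree: `directSumTensor`, `kroneckerPow`) and a
bijection `e : Fin m ⊕ Fin k ≃ Fin n` fixing which positions carry `s` and which carry `t`:

* `joinWord e a₁ a₂` — the word of length `n` over `ι ⊕ ι'` reading the word `a₁` (length `m`, over
  `ι`) on the positions `e(inl ·)` and `a₂` (length `k`, over `ι'`) on the positions `e(inr ·)`;
  injective (`joinWord_injective`).
* `embWord e x y` — the function on words of length `n` over `ι ⊕ ι'` that is `x(a₁) y(a₂)` at
  `joinWord e a₁ a₂` and `0` at all other words (the vector `x ⊗ y ∈ V^{⊗m} ⊗ W^{⊗k} ⊂ (V ⊕ W)^{⊗n}`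
  placed on the positions prescribed by `e`); bilinear.
* `blockTensor e x y` — the same for 3-leg tensors: `x ⊠ y` placed leg-wise (`blockTensor_apply_joinWord`,
  vanishing off joined words, bilinearity, leg slices `blockTensor_slice₁`, symmetry under exchanging
  legs).
* `kroneckerPow_directSumTensor_eq_sum_blockTensor` — **main identity**:
  `(s ⊕ t)^{⊗n} = ∑_{S ⊆ [n]} blockTensor e_S (s^{⊗|S|}) (t^{⊗|Sᶜ|})`, where
  `e_S : Fin |S| ⊕ Fin |Sᶜ| ≃ Fin n` is the increasing enumeration of `S` and of its complement
  (Mathlib's `finSumEquivOfFinset`).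

All over a commutative semiring `K`. No named facts.

## References

* M. Christandl, P. Vrana, J. Zuiddam, J. Amer. Math. Soc. 36 (2023) 31–79 = arXiv:1709.07851v3,
  §1.1 (direct sum, tensor powers), proof of Lemma 3.11. [ChristandlVranaZuiddam2023]
-/

noncomputable section

open scoped BigOperators

namespace Literature.Computability.AlgebraicComplexity

/-! ## §1 Joined words -/

section Join

variable {α α' : Type*} {m k n : ℕ}

/-- The word of length `n` over `α ⊕ α'` with the word `a₁` (over `α`) on the positions `e(inl ·)`
and the word `a₂` (over `α'`) on the positions `e(inr ·)`. [folklore] -/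
def joinWord (e : Fin m ⊕ Fin k ≃ Fin n) (a₁ : Fin m → α) (a₂ : Fin k → α') : Fin n → α ⊕ α' :=
  fun p => Sum.elim (fun i => Sum.inl (a₁ i)) (fun j => Sum.inr (a₂ j)) (e.symm p)

/-- The letters of a joined word on the positions of the first kind. [folklore] -/
@[simp] theorem joinWord_apply_inl (e : Fin m ⊕ Fin k ≃ Fin n) (a₁ : Fin m → α) (a₂ : Fin k → α')
    (i : Fin m) : joinWord e a₁ a₂ (e (Sum.inl i)) = Sum.inl (a₁ i) := by
  simp [joinWord]

/-- The letters of a joined word on the positions of the second kind. [folklore] -/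
@[simp] theorem joinWord_apply_inr (e : Fin m ⊕ Fin k ≃ Fin n) (a₁ : Fin m → α) (a₂ : Fin k → α')
    (j : Fin k) : joinWord e a₁ a₂ (e (Sum.inr j)) = Sum.inr (a₂ j) := by
  simp [joinWord]

/-- The letter at position `p` of a joined word. [folklore] -/
theorem joinWord_apply (e : Fin m ⊕ Fin k ≃ Fin n) (a₁ : Fin m → α) (a₂ : Fin k → α') (p : Fin n) :
    joinWord e a₁ a₂ p = Sum.elim (fun i => Sum.inl (a₁ i)) (fun j => Sum.inr (a₂ j)) (e.symm p) := rfl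

/-- `joinWord e` is injective in the pair of words. [folklore] -/
theorem joinWord_injective (e : Fin m ⊕ Fin k ≃ Fin n) {a₁ a₁' : Fin m → α} {a₂ a₂' : Fin k → α'}
    (h : joinWord e a₁ a₂ = joinWord e a₁' a₂') : a₁ = a₁' ∧ a₂ = a₂' := by
  constructor
  · funext i
    have := congrFun h (e (Sum.inl i))
    simpa using this
  · funext j
    have := congrFun h (e (Sum.inr j))
    simpa using this

/-- A word reading letters of `α` on the positions `e(inl ·)` and letters of `α'` on the positions
`e(inr ·)` is a joined word. [folklore] -/
theorem exists_eq_joinWord (e : Fin m ⊕ Fin k ≃ Fin n) {u : Fin n → α ⊕ α'}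
    (h₁ : ∀ i, ∃ a, u (e (Sum.inl i)) = Sum.inl a) (h₂ : ∀ j, ∃ a', u (e (Sum.inr j)) = Sum.inr a') :
    ∃ (a₁ : Fin m → α) (a₂ : Fin k → α'), u = joinWord e a₁ a₂ := by
  classical
  refine ⟨fun i => Classical.choose (h₁ i), fun j => Classical.choose (h₂ j), funext fun p => ?_⟩
  rw [joinWord_apply]
  obtain ⟨x, hx⟩ : ∃ x, e x = p := e.surjective p
  subst hx
  rcases x with i | j
  · simp only [Equiv.symm_apply_apply, Sum.elim_inl]
    exact Classical.choose_spec (h₁ i)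
  · simp only [Equiv.symm_apply_apply, Sum.elim_inr]
    exact Classical.choose_spec (h₂ j)

/-- **Collapsing a double sum against a joined word**: for `u = joinWord e a₁ a₂` only the term
`(a₁, a₂)` survives. [folklore] -/
theorem sum_sum_ite_eq_joinWord [Fintype α] [Fintype α'] [DecidableEq α] [DecidableEq α']
    {M : Type*} [AddCommMonoid M] (e : Fin m ⊕ Fin k ≃ Fin n) (f : (Fin m → α) → (Fin k → α') → M)
    (a₁ : Fin m → α) (a₂ : Fin k → α') :
    (∑ b₁ : Fin m → α, ∑ b₂ : Fin k → α',
      if joinWord e a₁ a₂ = joinWord e b₁ b₂ then f b₁ b₂ else 0) = f a₁ a₂ := by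
  rw [Finset.sum_eq_single a₁, Finset.sum_eq_single a₂]
  · simp
  · intro b₂ _ hb₂
    rw [if_neg]
    intro h
    exact hb₂ (joinWord_injective e h).2.symm
  · intro h; exact absurd (Finset.mem_univ a₂) h
  · intro b₁ _ hb₁
    refine Finset.sum_eq_zero fun b₂ _ => ?_
    rw [if_neg]
    intro h
    exact hb₁ (joinWord_injective e h).1.symm
  · intro h; exact absurd (Finset.mem_univ a₁) h

/-- The double sum vanishes against a word that is not joined. [folklore] -/
theorem sum_sum_ite_eq_zero_of_ne [Fintype α] [Fintype α'] [DecidableEq α] [DecidableEq α']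
    {M : Type*} [AddCommMonoid M] (e : Fin m ⊕ Fin k ≃ Fin n) (f : (Fin m → α) → (Fin k → α') → M)
    {u : Fin n → α ⊕ α'} (hu : ∀ b₁ b₂, u ≠ joinWord e b₁ b₂) :
    (∑ b₁ : Fin m → α, ∑ b₂ : Fin k → α', if u = joinWord e b₁ b₂ then f b₁ b₂ else 0) = 0 :=
  Finset.sum_eq_zero fun b₁ _ => Finset.sum_eq_zero fun b₂ _ => if_neg (hu b₁ b₂)

end Join

/-! ## §2 Embedded products of functions on words -/

section Emb

variable {K : Type*} [CommSemiring K] {α α' : Type*} [Fintype α] [Fintype α'] [DecidableEq α]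
  [DecidableEq α'] {m k n : ℕ}

/-- **The embedded product** `x ⊗ y ∈ V^{⊗m} ⊗ W^{⊗k} ⊂ (V ⊕ W)^{⊗n}` on the positions prescribed by
`e`: the function on words of length `n` over `α ⊕ α'` with value `x(a₁) y(a₂)` at `joinWord e a₁ a₂`
and `0` at words that are not joined. [folklore] -/
def embWord (e : Fin m ⊕ Fin k ≃ Fin n) (x : (Fin m → α) → K) (y : (Fin k → α') → K) :
    (Fin n → α ⊕ α') → K :=
  fun u => ∑ a₁ : Fin m → α, ∑ a₂ : Fin k → α', if u = joinWord e a₁ a₂ then x a₁ * y a₂ else 0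

/-- Value of the embedded product at a joined word. [folklore] -/
@[simp] theorem embWord_apply_joinWord (e : Fin m ⊕ Fin k ≃ Fin n) (x : (Fin m → α) → K)
    (y : (Fin k → α') → K) (a₁ : Fin m → α) (a₂ : Fin k → α') :
    embWord e x y (joinWord e a₁ a₂) = x a₁ * y a₂ :=
  sum_sum_ite_eq_joinWord e (fun b₁ b₂ => x b₁ * y b₂) a₁ a₂

/-- The embedded product vanishes at words that are not joined. [folklore] -/
theorem embWord_apply_of_ne (e : Fin m ⊕ Fin k ≃ Fin n) (x : (Fin m → α) → K) (y : (Fin k → α') → K)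
    {u : Fin n → α ⊕ α'} (hu : ∀ b₁ b₂, u ≠ joinWord e b₁ b₂) : embWord e x y u = 0 :=
  sum_sum_ite_eq_zero_of_ne e _ hu

/-- Bilinearity: sums and scalars in the first slot. [folklore] -/
theorem embWord_sum_smul_left {σ : Type*} (S : Finset σ) (c : σ → K) (x : σ → (Fin m → α) → K)
    (e : Fin m ⊕ Fin k ≃ Fin n) (y : (Fin k → α') → K) :
    embWord e (∑ i ∈ S, c i • x i) y = ∑ i ∈ S, c i • embWord e (x i) y := by
  classical
  funext u
  simp only [Finset.sum_apply, Pi.smul_apply, smul_eq_mul]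
  by_cases hu : ∃ a₁ a₂, u = joinWord e a₁ a₂
  · obtain ⟨a₁, a₂, rfl⟩ := hu
    simp only [embWord_apply_joinWord, Finset.sum_apply, Pi.smul_apply, smul_eq_mul, Finset.sum_mul,
      mul_assoc]
  · push Not at hu
    simp only [embWord_apply_of_ne e _ _ hu, mul_zero, Finset.sum_const_zero]

/-- Bilinearity: sums and scalars in the second slot. [folklore] -/
theorem embWord_sum_smul_right {σ : Type*} (S : Finset σ) (c : σ → K) (e : Fin m ⊕ Fin k ≃ Fin n)
    (x : (Fin m → α) → K) (y : σ → (Fin k → α') → K) :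
    embWord e x (∑ i ∈ S, c i • y i) = ∑ i ∈ S, c i • embWord e x (y i) := by
  classical
  funext u
  simp only [Finset.sum_apply, Pi.smul_apply, smul_eq_mul]
  by_cases hu : ∃ a₁ a₂, u = joinWord e a₁ a₂
  · obtain ⟨a₁, a₂, rfl⟩ := hu
    simp only [embWord_apply_joinWord, Finset.sum_apply, Pi.smul_apply, smul_eq_mul, Finset.mul_sum]
    exact Finset.sum_congr rfl fun i _ => by ring
  · push Not at hu
    simp only [embWord_apply_of_ne e _ _ hu, mul_zero, Finset.sum_const_zero]

/-- The embedded product of a zero function vanishes. [folklore] -/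
@[simp] theorem embWord_zero_left (e : Fin m ⊕ Fin k ≃ Fin n) (y : (Fin k → α') → K) :
    embWord e (0 : (Fin m → α) → K) y = 0 := by
  funext u; simp [embWord]

/-- The embedded product of a zero function vanishes. [folklore] -/
@[simp] theorem embWord_zero_right (e : Fin m ⊕ Fin k ≃ Fin n) (x : (Fin m → α) → K) :
    embWord e x (0 : (Fin k → α') → K) = 0 := by
  funext u; simp [embWord]

end Emb

/-! ## §3 Block tensors -/

section Block

variable {K : Type*} [CommSemiring K] {ι κ μ ι' κ' μ' : Type*} [Fintype ι] [Fintype κ] [Fintype μ]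
  [Fintype ι'] [Fintype κ'] [Fintype μ'] [DecidableEq ι] [DecidableEq κ] [DecidableEq μ]
  [DecidableEq ι'] [DecidableEq κ'] [DecidableEq μ'] {m k n : ℕ}

/-- **The block tensor** `x ⊠ y` placed on the positions prescribed by `e`, for 3-leg tensors `x` on
words of length `m` over `(ι, κ, μ)` and `y` on words of length `k` over `(ι', κ', μ')`: the 3-leg
tensor on words of length `n` over `(ι ⊕ ι', κ ⊕ κ', μ ⊕ μ')` with value `x(a₁,b₁,c₁) y(a₂,b₂,c₂)` at
`(joinWord e a₁ a₂, joinWord e b₁ b₂, joinWord e c₁ c₂)` and `0` elsewhere (CVZ, proof of Lemma 3.11: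
the summand `s^{⊗m} ⊗ t^{⊗(n-m)}` of `(s ⊕ t)^{⊗n}` sitting on a fixed set of legs).
[cite: ChristandlVranaZuiddam2023, Lemma 3.11 (proof)] -/
def blockTensor (e : Fin m ⊕ Fin k ≃ Fin n) (x : (Fin m → ι) → (Fin m → κ) → (Fin m → μ) → K)
    (y : (Fin k → ι') → (Fin k → κ') → (Fin k → μ') → K) :
    (Fin n → ι ⊕ ι') → (Fin n → κ ⊕ κ') → (Fin n → μ ⊕ μ') → K :=
  fun u v w => ∑ a₁ : Fin m → ι, ∑ a₂ : Fin k → ι', if u = joinWord e a₁ a₂ then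
    ∑ b₁ : Fin m → κ, ∑ b₂ : Fin k → κ', if v = joinWord e b₁ b₂ then
      ∑ c₁ : Fin m → μ, ∑ c₂ : Fin k → μ', if w = joinWord e c₁ c₂ then x a₁ b₁ c₁ * y a₂ b₂ c₂ else 0
    else 0
  else 0

/-- Value of the block tensor at a triple of joined words. [folklore] -/
@[simp] theorem blockTensor_apply_joinWord (e : Fin m ⊕ Fin k ≃ Fin n)
    (x : (Fin m → ι) → (Fin m → κ) → (Fin m → μ) → K)
    (y : (Fin k → ι') → (Fin k → κ') → (Fin k → μ') → K) (a₁ : Fin m → ι) (a₂ : Fin k → ι')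
    (b₁ : Fin m → κ) (b₂ : Fin k → κ') (c₁ : Fin m → μ) (c₂ : Fin k → μ') :
    blockTensor e x y (joinWord e a₁ a₂) (joinWord e b₁ b₂) (joinWord e c₁ c₂) =
      x a₁ b₁ c₁ * y a₂ b₂ c₂ := by
  unfold blockTensor
  rw [sum_sum_ite_eq_joinWord e, sum_sum_ite_eq_joinWord e, sum_sum_ite_eq_joinWord e]

/-- The block tensor vanishes when the first word is not joined. [folklore] -/
theorem blockTensor_apply_of_ne₁ (e : Fin m ⊕ Fin k ≃ Fin n)
    (x : (Fin m → ι) → (Fin m → κ) → (Fin m → μ) → K)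
    (y : (Fin k → ι') → (Fin k → κ') → (Fin k → μ') → K) {u : Fin n → ι ⊕ ι'}
    (hu : ∀ a₁ a₂, u ≠ joinWord e a₁ a₂) (v : Fin n → κ ⊕ κ') (w : Fin n → μ ⊕ μ') :
    blockTensor e x y u v w = 0 :=
  sum_sum_ite_eq_zero_of_ne e _ hu

/-- The block tensor vanishes when the second word is not joined. [folklore] -/
theorem blockTensor_apply_of_ne₂ (e : Fin m ⊕ Fin k ≃ Fin n)
    (x : (Fin m → ι) → (Fin m → κ) → (Fin m → μ) → K)
    (y : (Fin k → ι') → (Fin k → κ') → (Fin k → μ') → K) (u : Fin n → ι ⊕ ι') {v : Fin n → κ ⊕ κ'}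
    (hv : ∀ b₁ b₂, v ≠ joinWord e b₁ b₂) (w : Fin n → μ ⊕ μ') :
    blockTensor e x y u v w = 0 := by
  unfold blockTensor
  refine Finset.sum_eq_zero fun a₁ _ => Finset.sum_eq_zero fun a₂ _ => ?_
  rw [sum_sum_ite_eq_zero_of_ne e _ hv, ite_self]

/-- The block tensor vanishes when the third word is not joined. [folklore] -/
theorem blockTensor_apply_of_ne₃ (e : Fin m ⊕ Fin k ≃ Fin n)
    (x : (Fin m → ι) → (Fin m → κ) → (Fin m → μ) → K)
    (y : (Fin k → ι') → (Fin k → κ') → (Fin k → μ') → K) (u : Fin n → ι ⊕ ι') (v : Fin n → κ ⊕ κ')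
    {w : Fin n → μ ⊕ μ'} (hw : ∀ c₁ c₂, w ≠ joinWord e c₁ c₂) :
    blockTensor e x y u v w = 0 := by
  unfold blockTensor
  refine Finset.sum_eq_zero fun a₁ _ => Finset.sum_eq_zero fun a₂ _ => ?_
  have : ∀ b₁ b₂, (∑ c₁ : Fin m → μ, ∑ c₂ : Fin k → μ',
      if w = joinWord e c₁ c₂ then x a₁ b₁ c₁ * y a₂ b₂ c₂ else 0) = 0 :=
    fun b₁ b₂ => sum_sum_ite_eq_zero_of_ne e _ hw
  simp only [this, ite_self, Finset.sum_const_zero]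

/-- **The first-leg slices of a block tensor are embedded products**: at joined words
`v = joinWord e b₁ b₂`, `w = joinWord e c₁ c₂` the slice `u ↦ (x ⊠ y)(u, v, w)` is
`embWord e x(·,b₁,c₁) y(·,b₂,c₂)`. [folklore] -/
theorem blockTensor_slice₁ (e : Fin m ⊕ Fin k ≃ Fin n)
    (x : (Fin m → ι) → (Fin m → κ) → (Fin m → μ) → K)
    (y : (Fin k → ι') → (Fin k → κ') → (Fin k → μ') → K) (b₁ : Fin m → κ) (b₂ : Fin k → κ')
    (c₁ : Fin m → μ) (c₂ : Fin k → μ') :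
    (fun u => blockTensor e x y u (joinWord e b₁ b₂) (joinWord e c₁ c₂)) =
      embWord e (fun a₁ => x a₁ b₁ c₁) (fun a₂ => y a₂ b₂ c₂) := by
  funext u
  unfold blockTensor embWord
  refine Finset.sum_congr rfl fun a₁ _ => Finset.sum_congr rfl fun a₂ _ => ?_
  split_ifs with h
  · rw [sum_sum_ite_eq_joinWord e, sum_sum_ite_eq_joinWord e]
  · rfl

/-- Exchanging the first two legs of a block tensor. [folklore] -/
theorem blockTensor_swap₁₂ (e : Fin m ⊕ Fin k ≃ Fin n)
    (x : (Fin m → ι) → (Fin m → κ) → (Fin m → μ) → K)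
    (y : (Fin k → ι') → (Fin k → κ') → (Fin k → μ') → K) (u : Fin n → ι ⊕ ι') (v : Fin n → κ ⊕ κ')
    (w : Fin n → μ ⊕ μ') :
    blockTensor e x y u v w =
      blockTensor e (fun b a c => x a b c) (fun b a c => y a b c) v u w := by
  classical
  -- both sides vanish unless `u`, `v`, `w` are joined, in which case they agree
  by_cases hu : ∃ a₁ a₂, u = joinWord e a₁ a₂
  · obtain ⟨a₁, a₂, rfl⟩ := hu
    by_cases hv : ∃ b₁ b₂, v = joinWord e b₁ b₂
    · obtain ⟨b₁, b₂, rfl⟩ := hv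
      by_cases hw : ∃ c₁ c₂, w = joinWord e c₁ c₂
      · obtain ⟨c₁, c₂, rfl⟩ := hw
        rw [blockTensor_apply_joinWord, blockTensor_apply_joinWord]
      · push Not at hw
        rw [blockTensor_apply_of_ne₃ e _ _ _ _ hw, blockTensor_apply_of_ne₃ e _ _ _ _ hw]
    · push Not at hv
      rw [blockTensor_apply_of_ne₂ e _ _ _ hv, blockTensor_apply_of_ne₁ e _ _ hv]
  · push Not at hu
    rw [blockTensor_apply_of_ne₁ e _ _ hu, blockTensor_apply_of_ne₂ e _ _ _ hu]

/-- Exchanging the first and third legs of a block tensor. [folklore] -/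
theorem blockTensor_swap₁₃ (e : Fin m ⊕ Fin k ≃ Fin n)
    (x : (Fin m → ι) → (Fin m → κ) → (Fin m → μ) → K)
    (y : (Fin k → ι') → (Fin k → κ') → (Fin k → μ') → K) (u : Fin n → ι ⊕ ι') (v : Fin n → κ ⊕ κ')
    (w : Fin n → μ ⊕ μ') :
    blockTensor e x y u v w =
      blockTensor e (fun c b a => x a b c) (fun c b a => y a b c) w v u := by
  classical
  by_cases hu : ∃ a₁ a₂, u = joinWord e a₁ a₂
  · obtain ⟨a₁, a₂, rfl⟩ := hu
    by_cases hv : ∃ b₁ b₂, v = joinWord e b₁ b₂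
    · obtain ⟨b₁, b₂, rfl⟩ := hv
      by_cases hw : ∃ c₁ c₂, w = joinWord e c₁ c₂
      · obtain ⟨c₁, c₂, rfl⟩ := hw
        rw [blockTensor_apply_joinWord, blockTensor_apply_joinWord]
      · push Not at hw
        rw [blockTensor_apply_of_ne₃ e _ _ _ _ hw, blockTensor_apply_of_ne₁ e _ _ hw]
    · push Not at hv
      rw [blockTensor_apply_of_ne₂ e _ _ _ hv, blockTensor_apply_of_ne₂ e _ _ _ hv]
  · push Not at hu
    rw [blockTensor_apply_of_ne₁ e _ _ hu, blockTensor_apply_of_ne₃ e _ _ _ _ hu]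

/-- Bilinearity of the block tensor: sums and scalars in the first slot. [folklore] -/
theorem blockTensor_sum_smul_left {σ : Type*} (S : Finset σ) (c : σ → K)
    (x : σ → (Fin m → ι) → (Fin m → κ) → (Fin m → μ) → K) (e : Fin m ⊕ Fin k ≃ Fin n)
    (y : (Fin k → ι') → (Fin k → κ') → (Fin k → μ') → K) :
    blockTensor e (∑ i ∈ S, c i • x i) y = ∑ i ∈ S, c i • blockTensor e (x i) y := by
  classical
  funext u v w
  simp only [Finset.sum_apply, Pi.smul_apply, smul_eq_mul]
  by_cases hu : ∃ a₁ a₂, u = joinWord e a₁ a₂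
  · obtain ⟨a₁, a₂, rfl⟩ := hu
    by_cases hv : ∃ b₁ b₂, v = joinWord e b₁ b₂
    · obtain ⟨b₁, b₂, rfl⟩ := hv
      by_cases hw : ∃ c₁ c₂, w = joinWord e c₁ c₂
      · obtain ⟨c₁, c₂, rfl⟩ := hw
        simp only [blockTensor_apply_joinWord, Finset.sum_apply, Pi.smul_apply, smul_eq_mul,
          Finset.sum_mul, mul_assoc]
      · push Not at hw
        simp only [blockTensor_apply_of_ne₃ e _ _ _ _ hw, mul_zero, Finset.sum_const_zero]
    · push Not at hv
      simp only [blockTensor_apply_of_ne₂ e _ _ _ hv, mul_zero, Finset.sum_const_zero]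
  · push Not at hu
    simp only [blockTensor_apply_of_ne₁ e _ _ hu, mul_zero, Finset.sum_const_zero]

/-- Bilinearity of the block tensor: sums and scalars in the second slot. [folklore] -/
theorem blockTensor_sum_smul_right {σ : Type*} (S : Finset σ) (c : σ → K) (e : Fin m ⊕ Fin k ≃ Fin n)
    (x : (Fin m → ι) → (Fin m → κ) → (Fin m → μ) → K)
    (y : σ → (Fin k → ι') → (Fin k → κ') → (Fin k → μ') → K) :
    blockTensor e x (∑ i ∈ S, c i • y i) = ∑ i ∈ S, c i • blockTensor e x (y i) := by
  classical
  funext u v w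
  simp only [Finset.sum_apply, Pi.smul_apply, smul_eq_mul]
  by_cases hu : ∃ a₁ a₂, u = joinWord e a₁ a₂
  · obtain ⟨a₁, a₂, rfl⟩ := hu
    by_cases hv : ∃ b₁ b₂, v = joinWord e b₁ b₂
    · obtain ⟨b₁, b₂, rfl⟩ := hv
      by_cases hw : ∃ c₁ c₂, w = joinWord e c₁ c₂
      · obtain ⟨c₁, c₂, rfl⟩ := hw
        simp only [blockTensor_apply_joinWord, Finset.sum_apply, Pi.smul_apply, smul_eq_mul,
          Finset.mul_sum]
        exact Finset.sum_congr rfl fun i _ => by ring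
      · push Not at hw
        simp only [blockTensor_apply_of_ne₃ e _ _ _ _ hw, mul_zero, Finset.sum_const_zero]
    · push Not at hv
      simp only [blockTensor_apply_of_ne₂ e _ _ _ hv, mul_zero, Finset.sum_const_zero]
  · push Not at hu
    simp only [blockTensor_apply_of_ne₁ e _ _ hu, mul_zero, Finset.sum_const_zero]

end Block

/-! ## §4 The tensor power of a direct sum -/

section Power

variable {K : Type*} [CommSemiring K] {ι κ μ ι' κ' μ' : Type*} {n : ℕ}

/-- The increasing enumeration `Fin |S| ⊕ Fin |Sᶜ| ≃ Fin n` of a set of positions and of its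
complement (Mathlib's `finSumEquivOfFinset`). [folklore] -/
abbrev finsetSplit (S : Finset (Fin n)) : Fin S.card ⊕ Fin Sᶜ.card ≃ Fin n :=
  finSumEquivOfFinset rfl rfl

/-- The positions `e_S(inl ·)` are the elements of `S`. [folklore] -/
theorem finsetSplit_inl_mem (S : Finset (Fin n)) (i : Fin S.card) : finsetSplit S (Sum.inl i) ∈ S := by
  rw [finsetSplit, finSumEquivOfFinset_inl]
  exact Finset.orderEmbOfFin_mem S rfl i

/-- The positions `e_S(inr ·)` are the elements of `Sᶜ`. [folklore] -/
theorem finsetSplit_inr_not_mem (S : Finset (Fin n)) (j : Fin Sᶜ.card) : finsetSplit S (Sum.inr j) ∉ S := by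
  rw [finsetSplit, finSumEquivOfFinset_inr, ← Finset.mem_compl]
  exact Finset.orderEmbOfFin_mem Sᶜ rfl j

/-- A position in `S` is some `e_S(inl i)`. [folklore] -/
theorem exists_finsetSplit_inl_eq {S : Finset (Fin n)} {p : Fin n} (hp : p ∈ S) :
    ∃ i, finsetSplit S (Sum.inl i) = p := by
  obtain ⟨x, hx⟩ := (finsetSplit S).surjective p
  rcases x with i | j
  · exact ⟨i, hx⟩
  · exact absurd (hx ▸ hp) (finsetSplit_inr_not_mem S j)

/-- A position outside `S` is some `e_S(inr j)`. [folklore] -/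
theorem exists_finsetSplit_inr_eq {S : Finset (Fin n)} {p : Fin n} (hp : p ∉ S) :
    ∃ j, finsetSplit S (Sum.inr j) = p := by
  obtain ⟨x, hx⟩ := (finsetSplit S).surjective p
  rcases x with i | j
  · exact absurd (hx ▸ finsetSplit_inl_mem S i) hp
  · exact ⟨j, hx⟩

/-- The letters of an `e_S`-joined word over `α ⊕ α'` are of the first kind exactly on `S`.
[folklore] -/
theorem isLeft_joinWord_finsetSplit {α α' : Type*} (S : Finset (Fin n)) (a₁ : Fin S.card → α)
    (a₂ : Fin Sᶜ.card → α') (p : Fin n) : (joinWord (finsetSplit S) a₁ a₂ p).isLeft = decide (p ∈ S) := by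
  by_cases hp : p ∈ S
  · obtain ⟨i, hi⟩ := exists_finsetSplit_inl_eq hp
    rw [← hi, joinWord_apply_inl, hi, decide_eq_true hp]
    rfl
  · obtain ⟨j, hj⟩ := exists_finsetSplit_inr_eq hp
    rw [← hj, joinWord_apply_inr, hj, decide_eq_false hp]
    rfl

/-- A word over `α ⊕ α'` whose letters of the first kind sit exactly on `S` is `e_S`-joined.
[folklore] -/
theorem exists_eq_joinWord_finsetSplit {α α' : Type*} (S : Finset (Fin n)) {u : Fin n → α ⊕ α'}
    (hu : ∀ p, (u p).isLeft = decide (p ∈ S)) :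
    ∃ (a₁ : Fin S.card → α) (a₂ : Fin Sᶜ.card → α'), u = joinWord (finsetSplit S) a₁ a₂ := by
  refine exists_eq_joinWord _ (fun i => ?_) (fun j => ?_)
  · have h := hu (finsetSplit S (Sum.inl i))
    rw [decide_eq_true (finsetSplit_inl_mem S i)] at h
    exact Sum.isLeft_iff.1 h
  · have h := hu (finsetSplit S (Sum.inr j))
    rw [decide_eq_false (finsetSplit_inr_not_mem S j)] at h
    rcases hx : u (finsetSplit S (Sum.inr j)) with a | a'
    · rw [hx] at h
      exact absurd h (by simp)
    · exact ⟨a', rfl⟩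

/-- An `e_S`-joined word cannot be `e_T`-joined for `T ≠ S`. [folklore] -/
theorem ne_joinWord_finsetSplit_of_ne {α α' : Type*} {S T : Finset (Fin n)} (hST : S ≠ T)
    (a₁ : Fin S.card → α) (a₂ : Fin Sᶜ.card → α') (b₁ : Fin T.card → α) (b₂ : Fin Tᶜ.card → α') :
    joinWord (finsetSplit S) a₁ a₂ ≠ joinWord (finsetSplit T) b₁ b₂ := by
  intro h
  apply hST
  ext p
  have h1 := isLeft_joinWord_finsetSplit S a₁ a₂ p
  have h2 := isLeft_joinWord_finsetSplit T b₁ b₂ p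
  rw [h] at h1
  rw [h1] at h2
  simpa using h2

/-- The entry of `(s ⊕ t)^{⊗n}` at a triple of `e_S`-joined words factors into the entries of
`s^{⊗|S|}` and `t^{⊗|Sᶜ|}`. [cite: ChristandlVranaZuiddam2023, Lemma 3.11 (proof)] -/
theorem kroneckerPow_directSumTensor_joinWord (s : ι → κ → μ → K) (t : ι' → κ' → μ' → K)
    {m k : ℕ} (e : Fin m ⊕ Fin k ≃ Fin n) (a₁ : Fin m → ι) (a₂ : Fin k → ι') (b₁ : Fin m → κ)
    (b₂ : Fin k → κ') (c₁ : Fin m → μ) (c₂ : Fin k → μ') :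
    kroneckerPow (directSumTensor s t) n (joinWord e a₁ a₂) (joinWord e b₁ b₂) (joinWord e c₁ c₂) =
      kroneckerPow s m a₁ b₁ c₁ * kroneckerPow t k a₂ b₂ c₂ := by
  simp only [kroneckerPow_apply]
  rw [← Fintype.prod_equiv e (fun x => directSumTensor s t (joinWord e a₁ a₂ (e x))
      (joinWord e b₁ b₂ (e x)) (joinWord e c₁ c₂ (e x))) _ (fun _ => rfl), Fintype.prod_sum_type]
  simp only [joinWord_apply_inl, joinWord_apply_inr, directSumTensor_inl, directSumTensor_inr]

/-- An entry of `(s ⊕ t)^{⊗n}` vanishes unless the three words have letters of the first kind on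
the same positions. [cite: ChristandlVranaZuiddam2023, §1.1] -/
theorem kroneckerPow_directSumTensor_eq_zero_of_isLeft_ne (s : ι → κ → μ → K) (t : ι' → κ' → μ' → K)
    {u : Fin n → ι ⊕ ι'} {v : Fin n → κ ⊕ κ'} {w : Fin n → μ ⊕ μ'} {p : Fin n}
    (h : (u p).isLeft ≠ (v p).isLeft ∨ (u p).isLeft ≠ (w p).isLeft) :
    kroneckerPow (directSumTensor s t) n u v w = 0 := by
  rw [kroneckerPow_apply]
  refine Finset.prod_eq_zero (Finset.mem_univ p) ?_
  rcases hu : u p with a | a <;> rcases hv : v p with b | b <;> rcases hw : w p with c | c <;>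
    first
    | rfl
    | (rw [hu, hv, hw] at h; simp at h)

variable [Fintype ι] [Fintype κ] [Fintype μ] [Fintype ι'] [Fintype κ'] [Fintype μ'] [DecidableEq ι]
  [DecidableEq κ] [DecidableEq μ] [DecidableEq ι'] [DecidableEq κ'] [DecidableEq μ']

/-- **`(s ⊕ t)^{⊗n}` is the sum of its position blocks**:
`(s ⊕ t)^{⊗n} = ∑_{S ⊆ [n]} (s^{⊗|S|} ⊠ t^{⊗|Sᶜ|})` placed along the increasing enumerations `e_S`
(CVZ, proof of Lemma 3.11: "`(s ⊕ t)^{⊗n} ≅ ⊕_m ⊕_{\\binom{n}{m}} s^{⊗m} ⊗ t^{⊗(n-m)}`").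
[cite: ChristandlVranaZuiddam2023, Lemma 3.11 (proof)] -/
theorem kroneckerPow_directSumTensor_eq_sum_blockTensor (s : ι → κ → μ → K) (t : ι' → κ' → μ' → K) :
    kroneckerPow (directSumTensor s t) n =
      ∑ S : Finset (Fin n), blockTensor (finsetSplit S) (kroneckerPow s S.card) (kroneckerPow t Sᶜ.card) := by
  classical
  funext u v w
  rw [Finset.sum_apply, Finset.sum_apply, Finset.sum_apply]
  -- the pattern of `u`
  obtain ⟨S₀, hu⟩ : ∃ S₀ : Finset (Fin n), ∀ p, (u p).isLeft = decide (p ∈ S₀) :=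
    ⟨Finset.univ.filter fun p => (u p).isLeft, fun p => by simp⟩
  by_cases hcons : ∀ p, (u p).isLeft = (v p).isLeft ∧ (u p).isLeft = (w p).isLeft
  · -- consistent patterns: only the block `S₀` contributes
    have hv : ∀ p, (v p).isLeft = decide (p ∈ S₀) := fun p => ((hcons p).1).symm.trans (hu p)
    have hw : ∀ p, (w p).isLeft = decide (p ∈ S₀) := fun p => ((hcons p).2).symm.trans (hu p)
    obtain ⟨a₁, a₂, hua⟩ := exists_eq_joinWord_finsetSplit S₀ hu
    obtain ⟨b₁, b₂, hvb⟩ := exists_eq_joinWord_finsetSplit S₀ hv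
    obtain ⟨c₁, c₂, hwc⟩ := exists_eq_joinWord_finsetSplit S₀ hw
    rw [hua, hvb, hwc, Finset.sum_eq_single S₀, blockTensor_apply_joinWord,
      kroneckerPow_directSumTensor_joinWord]
    · intro T _ hT
      exact blockTensor_apply_of_ne₁ _ _ _ (fun b₁' b₂' => ne_joinWord_finsetSplit_of_ne (Ne.symm hT) _ _ _ _) _ _
    · intro h; exact absurd (Finset.mem_univ S₀) h
  · -- inconsistent patterns: everything vanishes
    push Not at hcons
    obtain ⟨p, hp⟩ := hcons
    have hp' : (u p).isLeft ≠ (v p).isLeft ∨ (u p).isLeft ≠ (w p).isLeft := by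
      by_cases h1 : (u p).isLeft = (v p).isLeft
      · exact Or.inr (hp h1)
      · exact Or.inl h1
    rw [kroneckerPow_directSumTensor_eq_zero_of_isLeft_ne s t hp']
    symm
    refine Finset.sum_eq_zero fun T _ => ?_
    -- if `u`, `v`, `w` were all `e_T`-joined their patterns would agree at `p`
    by_cases hU : ∃ a₁ a₂, u = joinWord (finsetSplit T) a₁ a₂
    · obtain ⟨a₁, a₂, hua⟩ := hU
      by_cases hV : ∃ b₁ b₂, v = joinWord (finsetSplit T) b₁ b₂
      · obtain ⟨b₁, b₂, hvb⟩ := hV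
        by_cases hW : ∃ c₁ c₂, w = joinWord (finsetSplit T) c₁ c₂
        · obtain ⟨c₁, c₂, hwc⟩ := hW
          exfalso
          have e1 := isLeft_joinWord_finsetSplit T a₁ a₂ p
          have e2 := isLeft_joinWord_finsetSplit T b₁ b₂ p
          have e3 := isLeft_joinWord_finsetSplit T c₁ c₂ p
          rw [← hua] at e1; rw [← hvb] at e2; rw [← hwc] at e3
          rcases hp' with h | h
          · exact h (e1.trans e2.symm)
          · exact h (e1.trans e3.symm)
        · push Not at hW
          exact blockTensor_apply_of_ne₃ _ _ _ _ _ hW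
      · push Not at hV
        exact blockTensor_apply_of_ne₂ _ _ _ _ hV _
    · push Not at hU
      exact blockTensor_apply_of_ne₁ _ _ _ hU _ _

end Power

end Literature.Computability.AlgebraicComplexity

end
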